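import Mathlib.RingTheory.Polynomial.ScaleRoots
import Mathlib.RingTheory.Localization.Away.Basic
import Mathlib.RingTheory.Polynomial.Quotient
import Mathlib.RingTheory.Polynomial.Basic
import Mathlib.Algebra.MvPolynomial.Equiv
import Mathlib.Algebra.MvPolynomial.PDeriv
import Mathlib.RingTheory.Ideal.Quotient.Operations
import Mathlib.Tactic
import HarnessLib

/-!
# BED Ω ROW ENGINE, integrality: the pencil chart `R[W]/(M·W − B)` is a DOMAIN when `B` is regular modulo `M` (so `(G, M·W − B)` is PRIME in `k[Y]` for `G` prime, `G ∤ M`,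
# `B` regular on `k[Y]/(G, M)`) — the LEGAL clause's integrality input for pencil floors, the per-row hypothesis `hprime` of ✓p692285 `PencilFedderFull` discharged from a
# checkable regular-sequence condition (crux `FInjectiveMacaulayfication` stmt-ResolutionOfSingularities-15315, chain w45a; seat res-L1-w45a-stub-1 g14, ON CALL per SEAT TABLE v35.0)

[OURS · L1 W4.5a] Support file (`--supports stmt-ResolutionOfSingularities-15315 --as helper`); theorems only; unconditional; ANY commutative domain / any field. Nothing of the crux
is proved; no census row is asserted. AI-written (AI review is weaker than expert review).

* §1 (any domain `R`, `M ≠ 0`, `B` regular modulo `M`, i.e. `B·t ∈ (M) ⇒ t ∈ (M)`): `mem_span_of_C_mul_mem` — `M` is a non-zero-divisor modulo `(M·W − B)` (coefficientwise: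
  `B·t_i = M·((W t)_i − f_i) ∈ (M)`); `mem_span_of_C_pow_mul_mem`; ★ `span_eq_ker_eval₂` — `(M·W − B) = ker (R[W] → R[1/M], W ↦ B/M)` (scale the roots: `M^{deg f}·f(W) = g(M·W)` with
  `g = scaleRoots f M`, `g(B) = 0`, so `(W − B) ∣ g` and `M^{deg f}·f ∈ (M·W − B)`); ★★ `isPrime_span_C_mul_X_sub_C` — `(M·W − B)` is prime, `isDomain_pencilChart`.
* §2 (`k[Y₀..Y_n]`, the pencil variable `Y₀`, base polynomials renamed along `Fin.succ`): ★★ `pencilChart_isPrime` — `G` prime, `G ∤ M`, `B` regular on `k[Y]/(G, M)` ⇒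
  `(G⁺, M⁺·Y₀ − B⁺)` is prime in `k[Y₀..Y_n]` (`q⁺ = rename Fin.succ q`); through `MvPolynomial.finSuccEquiv` and `Polynomial.ker_mapRingHom`.
* §3 (v2) `rename_finRotate_castSucc`, ★★ `pencilChart_isPrime_last` — the same in ✓p689316's `Fin.castSucc`/`Fin.last` convention (pencil variable `Y_n`).
[folklore; cite: Matsumura1987, Thm. 17.4 (regular sequences); the scaled-roots identity is Mathlib `Polynomial.scaleRoots_eval₂_mul`]
-/

set_option linter.dupNamespace false

noncomputable section

open Polynomial

namespace Summit.ResolutionOfSingularities.ResolutionOfSingularities.Theorems.FInjectiveMacaulayfication.PencilIntegral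

/-! ## §1 `R[W]/(M·W − B)` for `B` regular modulo `M` -/

section Generic

variable {R : Type} [CommRing R] [IsDomain R] (M B : R)

/-- **`M` is a non-zero-divisor modulo `(M·W − B)`** when `B` is regular modulo `M`: `M·f ∈ (M·W − B) ⇒ f ∈ (M·W − B)`. [folklore] -/
theorem mem_span_of_C_mul_mem (hM : M ≠ 0) (hreg : ∀ t : R, B * t ∈ Ideal.span {M} → t ∈ Ideal.span {M})
    (f : R[X]) (hf : C M * f ∈ Ideal.span {C M * X - C B}) : f ∈ Ideal.span {C M * X - C B} := by
  obtain ⟨t, ht⟩ := Ideal.mem_span_singleton'.1 hf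
  -- every coefficient of `t` is divisible by `M`
  have hcoeff : ∀ i, M ∣ t.coeff i := by
    intro i
    have h := congrArg (fun q : R[X] => q.coeff i) ht
    have e1 : t * (C M * X - C B) = C M * (X * t) - C B * t := by ring
    rw [e1] at h
    simp only [coeff_sub, coeff_C_mul] at h
    -- `h : M * (X * t).coeff i - B * t.coeff i = M * f.coeff i`
    have hBt : B * t.coeff i ∈ Ideal.span {M} :=
      Ideal.mem_span_singleton.2 ⟨(X * t).coeff i - f.coeff i, by linear_combination -h⟩
    exact Ideal.mem_span_singleton.1 (hreg _ hBt)
  obtain ⟨t', rfl⟩ := (C_dvd_iff_dvd_coeff M t).2 hcoeff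
  have hCM : (C M : R[X]) ≠ 0 := by rwa [Ne, C_eq_zero]
  have hft : f = t' * (C M * X - C B) := by
    apply mul_left_cancel₀ hCM
    rw [← ht]; ring
  rw [hft]
  exact Ideal.mul_mem_left _ _ (Ideal.mem_span_singleton_self _)

/-- Iterate: `M^N·f ∈ (M·W − B) ⇒ f ∈ (M·W − B)`. [folklore] -/
theorem mem_span_of_C_pow_mul_mem (hM : M ≠ 0) (hreg : ∀ t : R, B * t ∈ Ideal.span {M} → t ∈ Ideal.span {M})
    (N : ℕ) (f : R[X]) (hf : C M ^ N * f ∈ Ideal.span {C M * X - C B}) : f ∈ Ideal.span {C M * X - C B} := by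
  induction N generalizing f with
  | zero => simpa using hf
  | succ N ih =>
    apply ih
    apply mem_span_of_C_mul_mem M B hM hreg
    rw [← mul_assoc, ← pow_succ']; exact hf

/-- ★ **`(M·W − B)` IS THE KERNEL OF `R[W] → R[1/M]`, `W ↦ B/M`** (`R` a domain, `M ≠ 0`, `B` regular modulo `M`). [folklore] -/
theorem span_eq_ker_eval₂ (hM : M ≠ 0) (hreg : ∀ t : R, B * t ∈ Ideal.span {M} → t ∈ Ideal.span {M}) :
    Ideal.span {C M * X - C B} = RingHom.ker (eval₂RingHom (algebraMap R (Localization.Away M))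
      (IsLocalization.Away.invSelf M * algebraMap R (Localization.Away M) B)) := by
  set S := Localization.Away M with hS
  set alg := algebraMap R S with halg
  set r : S := IsLocalization.Away.invSelf M * alg B with hr
  have hMr : alg M * r = alg B := by
    rw [hr, ← mul_assoc, IsLocalization.Away.mul_invSelf, one_mul]
  have hinj : Function.Injective alg := IsLocalization.injective S (powers_le_nonZeroDivisors_of_noZeroDivisors hM)
  apply le_antisymm
  · rw [Ideal.span_le, Set.singleton_subset_iff, SetLike.mem_coe, RingHom.mem_ker]
    simp only [coe_eval₂RingHom, eval₂_sub, eval₂_mul, eval₂_C, eval₂_X]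
    rw [hMr, sub_self]
  · intro f hf
    rw [RingHom.mem_ker, coe_eval₂RingHom] at hf
    -- scale the roots: `g = scaleRoots f M`, `g(B) = 0`
    set g := f.scaleRoots M with hg
    have hgB : g.eval B = 0 := by
      apply hinj
      rw [map_zero, ← eval₂_hom, ← hMr, hg, scaleRoots_eval₂_mul, hf, mul_zero]
    obtain ⟨h, hh⟩ := dvd_iff_isRoot.2 hgB
    -- `M^{deg f} · f = g(M·W) = (M·W − B) · h(M·W)`
    have hcomp : g.comp (C M * X) = C M ^ f.natDegree * f := by
      have e := scaleRoots_eval₂_mul (p := f) (C : R →+* R[X]) X M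
      rw [eval₂_C_X] at e
      rw [← e, hg]; rfl
    have hmem : C M ^ f.natDegree * f ∈ Ideal.span {C M * X - C B} := by
      rw [← hcomp, hh, mul_comp, sub_comp, X_comp, C_comp]
      exact Ideal.mul_mem_right _ _ (Ideal.mem_span_singleton_self _)
    exact mem_span_of_C_pow_mul_mem M B hM hreg _ f hmem

/-- ★★ **`(M·W − B)` IS PRIME in `R[W]`** (`R` a domain, `M ≠ 0`, `B` regular modulo `M`). [folklore] -/
theorem isPrime_span_C_mul_X_sub_C (hM : M ≠ 0) (hreg : ∀ t : R, B * t ∈ Ideal.span {M} → t ∈ Ideal.span {M}) :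
    (Ideal.span {C M * X - C B} : Ideal R[X]).IsPrime := by
  haveI : IsDomain (Localization.Away M) := IsLocalization.isDomain_localization (powers_le_nonZeroDivisors_of_noZeroDivisors hM)
  rw [span_eq_ker_eval₂ M B hM hreg]
  exact RingHom.ker_isPrime _

/-- **The pencil chart `R[W]/(M·W − B)` is a domain.** [folklore] -/
theorem isDomain_pencilChart (hM : M ≠ 0) (hreg : ∀ t : R, B * t ∈ Ideal.span {M} → t ∈ Ideal.span {M}) :
    IsDomain (R[X] ⧸ (Ideal.span {C M * X - C B} : Ideal R[X])) :=
  haveI := isPrime_span_C_mul_X_sub_C M B hM hreg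
  Ideal.Quotient.isDomain _

end Generic

/-! ## §2 The pencil chart over `k[Y]/(G)`: `(G⁺, M⁺·Y₀ − B⁺)` is prime -/

section Pencil

variable (k : Type) [Field k] {n : ℕ}

/-- `finSuccEquiv` sends a base polynomial renamed along `Fin.succ` to the constant polynomial. [plumbing] -/
theorem finSuccEquiv_rename_succ (q : MvPolynomial (Fin n) k) :
    MvPolynomial.finSuccEquiv k n (MvPolynomial.rename Fin.succ q) = Polynomial.C q := by
  induction q using MvPolynomial.induction_on with
  | C c => rw [MvPolynomial.rename_C, MvPolynomial.finSuccEquiv_apply, MvPolynomial.eval₂Hom_C]; rfl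
  | add p q hp hq => rw [map_add, map_add, hp, hq, map_add]
  | mul_X p i hp => rw [map_mul, MvPolynomial.rename_X, map_mul, hp, MvPolynomial.finSuccEquiv_X_succ, ← map_mul]

/-- **Regularity of `B` modulo `M` descends to `k[Y]/(G)`**: `B·t ∈ (G, M) ⇒ t ∈ (G, M)` in `k[Y]` gives `B̄·t̄ ∈ (M̄) ⇒ t̄ ∈ (M̄)` in `k[Y]/(G)`. [plumbing] -/
theorem reg_quotient (G M B : MvPolynomial (Fin n) k)
    (hreg : ∀ t : MvPolynomial (Fin n) k, B * t ∈ Ideal.span {G, M} → t ∈ Ideal.span {G, M}) :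
    ∀ t : MvPolynomial (Fin n) k ⧸ Ideal.span {G},
      Ideal.Quotient.mk (Ideal.span {G}) B * t ∈ Ideal.span {Ideal.Quotient.mk (Ideal.span {G}) M} →
        t ∈ Ideal.span {Ideal.Quotient.mk (Ideal.span {G}) M} := by
  intro t ht
  obtain ⟨t, rfl⟩ := Ideal.Quotient.mk_surjective t
  obtain ⟨u, hu⟩ := Ideal.mem_span_singleton'.1 ht
  obtain ⟨u, rfl⟩ := Ideal.Quotient.mk_surjective u
  rw [← map_mul, ← map_mul, Ideal.Quotient.eq, Ideal.mem_span_singleton] at hu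
  obtain ⟨c, hc⟩ := hu
  have hBt : B * t ∈ Ideal.span {G, M} := by
    rw [show B * t = (-c) * G + u * M by linear_combination -hc]
    exact Ideal.add_mem _ (Ideal.mul_mem_left _ _ (Ideal.subset_span (Or.inl rfl))) (Ideal.mul_mem_left _ _ (Ideal.subset_span (Or.inr rfl)))
  obtain ⟨a, b, hab⟩ := Ideal.mem_span_pair.1 (hreg t hBt)
  rw [← hab, map_add, map_mul, map_mul, Ideal.Quotient.eq_zero_iff_mem.2 (Ideal.mem_span_singleton_self G), mul_zero, zero_add]
  exact Ideal.mul_mem_left _ _ (Ideal.mem_span_singleton_self _)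

/-- ★★ **THE PENCIL CHART IDEAL `(G⁺, M⁺·Y₀ − B⁺)` IS PRIME in `k[Y₀, Y₁, …, Y_n]`** (`q⁺ = rename Fin.succ q`, the pencil variable is `Y₀`): `G` prime, `G ∤ M`, and `B` regular on
`k[Y]/(G, M)` (`B·t ∈ (G, M) ⇒ t ∈ (G, M)`). Hence the `W`-chart `V(G) ×_{𝔸} {M·W = B}` of the blowing up of `V(G)` along the pencil `(M, B)` is INTEGRAL (and equals the
`M`-saturated chart). [folklore; cite: Matsumura1987, Thm. 17.4] -/
theorem pencilChart_isPrime (G M B : MvPolynomial (Fin n) k) (hG : Prime G) (hGM : ¬ G ∣ M)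
    (hreg : ∀ t : MvPolynomial (Fin n) k, B * t ∈ Ideal.span {G, M} → t ∈ Ideal.span {G, M}) :
    (Ideal.span {MvPolynomial.rename Fin.succ G, MvPolynomial.rename Fin.succ M * MvPolynomial.X 0 - MvPolynomial.rename Fin.succ B} :
      Ideal (MvPolynomial (Fin (n + 1)) k)).IsPrime := by
  classical
  set I : Ideal (MvPolynomial (Fin n) k) := Ideal.span {G} with hI
  haveI hIp : I.IsPrime := (Ideal.span_singleton_prime hG.ne_zero).mpr hG
  haveI : IsDomain (MvPolynomial (Fin n) k ⧸ I) := Ideal.Quotient.isDomain _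
  set mk := Ideal.Quotient.mk I with hmk
  have hM0 : mk M ≠ 0 := by
    rw [hmk, Ne, Ideal.Quotient.eq_zero_iff_mem, hI, Ideal.mem_span_singleton]; exact hGM
  have hprime := isPrime_span_C_mul_X_sub_C (mk M) (mk B) hM0 (reg_quotient k G M B hreg)
  -- the comparison map `ψ : k[Y₀..Y_n] ≅ k[Y][X] ↠ (k[Y]/(G))[X]`
  set e := MvPolynomial.finSuccEquiv k n with he
  set ψ : MvPolynomial (Fin (n + 1)) k →+* Polynomial (MvPolynomial (Fin n) k ⧸ I) :=
    (Polynomial.mapRingHom mk).comp (e : MvPolynomial (Fin (n + 1)) k →+* Polynomial (MvPolynomial (Fin n) k)) with hψ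
  have hψsurj : Function.Surjective ψ :=
    (Polynomial.map_surjective mk Ideal.Quotient.mk_surjective).comp e.surjective
  have hmkG : mk G = 0 := Ideal.Quotient.eq_zero_iff_mem.2 (Ideal.mem_span_singleton_self G)
  have hψG : ψ (MvPolynomial.rename Fin.succ G) = 0 := by
    simp only [hψ, RingHom.coe_comp, Function.comp_apply, RingHom.coe_coe, he, finSuccEquiv_rename_succ, Polynomial.coe_mapRingHom, Polynomial.map_C,
      hmkG, map_zero]
  have hψL : ψ (MvPolynomial.rename Fin.succ M * MvPolynomial.X 0 - MvPolynomial.rename Fin.succ B) = C (mk M) * X - C (mk B) := by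
    simp only [hψ, RingHom.coe_comp, Function.comp_apply, RingHom.coe_coe, map_sub, map_mul, he, finSuccEquiv_rename_succ, MvPolynomial.finSuccEquiv_X_zero,
      Polynomial.coe_mapRingHom, Polynomial.map_C, Polynomial.map_X]
  -- `ker ψ = (G⁺)`
  have hker : RingHom.ker ψ = Ideal.span {MvPolynomial.rename Fin.succ G} := by
    apply le_antisymm
    · intro f hf
      rw [RingHom.mem_ker, hψ, RingHom.comp_apply, ← RingHom.mem_ker, Polynomial.ker_mapRingHom, hmk, Ideal.mk_ker, hI, Ideal.map_span, Set.image_singleton,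
        Ideal.mem_span_singleton'] at hf
      obtain ⟨u, hu⟩ := hf
      rw [Ideal.mem_span_singleton']
      refine ⟨e.symm u, ?_⟩
      apply e.injective
      rw [map_mul, e.apply_symm_apply, he, finSuccEquiv_rename_succ]
      exact hu
    · rw [Ideal.span_le, Set.singleton_subset_iff]; exact hψG
  -- `(G⁺, L⁺) = ψ⁻¹ (M̄·X − B̄)`
  have hcomap : (Ideal.span {C (mk M) * X - C (mk B)}).comap ψ =
      Ideal.span {MvPolynomial.rename Fin.succ G, MvPolynomial.rename Fin.succ M * MvPolynomial.X 0 - MvPolynomial.rename Fin.succ B} := by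
    rw [← hψL, ← Set.image_singleton, ← Ideal.map_span, Ideal.comap_map_of_surjective ψ hψsurj, ← RingHom.ker_eq_comap_bot, hker,
      ← Ideal.span_union, Set.singleton_union, Set.pair_comm]
  rw [← hcomap]
  exact Ideal.comap_isPrime ψ _

end Pencil

/-! ## §3 (v2) The `Fin.castSucc` / `Fin.last` convention of ✓p689316 `PencilFedder` -/

section Bridge

variable (k : Type) [Field k] {n : ℕ}

/-- Renaming along `finRotate (n+1)` carries `q(Y_{castSucc ·})` to `q(Y_{succ ·})`. [plumbing] -/
theorem rename_finRotate_castSucc (q : MvPolynomial (Fin n) k) :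
    MvPolynomial.rename (finRotate (n + 1)) (MvPolynomial.rename Fin.castSucc q) = MvPolynomial.rename Fin.succ q := by
  rw [MvPolynomial.rename_rename]
  have h : (⇑(finRotate (n + 1)) ∘ Fin.castSucc : Fin n → Fin (n + 1)) = Fin.succ := by
    funext j
    show finRotate (n + 1) (Fin.castSucc j) = j.succ
    ext
    rw [coe_finRotate_of_ne_last (Fin.castSucc_lt_last j).ne, Fin.val_castSucc, Fin.val_succ]
  rw [h]

/-- ★★ **`pencilChart_isPrime` in the `Fin.castSucc`/`Fin.last` convention** (the pencil variable is `Y_n = X (Fin.last n)`, base polynomials renamed along `Fin.castSucc`, as in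
✓p689316 `PencilFedder.pencilChart_not_full_at`): `(G⁺, M⁺·Y_n − B⁺)` is prime. Transport of §2 along the ring automorphism `rename (finRotate (n+1))`. [folklore] -/
theorem pencilChart_isPrime_last (G M B : MvPolynomial (Fin n) k) (hG : Prime G) (hGM : ¬ G ∣ M)
    (hreg : ∀ t : MvPolynomial (Fin n) k, B * t ∈ Ideal.span {G, M} → t ∈ Ideal.span {G, M}) :
    (Ideal.span {MvPolynomial.rename Fin.castSucc G,
        MvPolynomial.rename Fin.castSucc M * MvPolynomial.X (Fin.last n) - MvPolynomial.rename Fin.castSucc B} : Ideal (MvPolynomial (Fin (n + 1)) k)).IsPrime := by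
  haveI := pencilChart_isPrime k G M B hG hGM hreg
  set ρ : MvPolynomial (Fin (n + 1)) k →+* MvPolynomial (Fin (n + 1)) k :=
    (MvPolynomial.renameEquiv k (finRotate (n + 1)) : MvPolynomial (Fin (n + 1)) k →+* MvPolynomial (Fin (n + 1)) k) with hρ
  have hρq : ∀ q : MvPolynomial (Fin n) k, ρ (MvPolynomial.rename Fin.castSucc q) = MvPolynomial.rename Fin.succ q := fun q => by
    rw [hρ, RingHom.coe_coe, MvPolynomial.renameEquiv_apply, rename_finRotate_castSucc]
  have hρX : ρ (MvPolynomial.X (Fin.last n)) = MvPolynomial.X 0 := by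
    rw [hρ, RingHom.coe_coe, MvPolynomial.renameEquiv_apply, MvPolynomial.rename_X, finRotate_last]
  have hsurj : Function.Surjective ρ := (MvPolynomial.renameEquiv k (finRotate (n + 1))).surjective
  have hinj : Function.Injective ρ := (MvPolynomial.renameEquiv k (finRotate (n + 1))).injective
  have hmap : Ideal.map ρ (Ideal.span {MvPolynomial.rename Fin.castSucc G,
        MvPolynomial.rename Fin.castSucc M * MvPolynomial.X (Fin.last n) - MvPolynomial.rename Fin.castSucc B}) =
      Ideal.span {MvPolynomial.rename Fin.succ G, MvPolynomial.rename Fin.succ M * MvPolynomial.X 0 - MvPolynomial.rename Fin.succ B} := by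
    rw [Ideal.map_span, Set.image_pair, map_sub, map_mul, hρq, hρq, hρq, hρX]
  have hcomap : Ideal.span {MvPolynomial.rename Fin.castSucc G,
        MvPolynomial.rename Fin.castSucc M * MvPolynomial.X (Fin.last n) - MvPolynomial.rename Fin.castSucc B} =
      (Ideal.span {MvPolynomial.rename Fin.succ G, MvPolynomial.rename Fin.succ M * MvPolynomial.X 0 - MvPolynomial.rename Fin.succ B}).comap ρ := by
    rw [← hmap, Ideal.comap_map_of_surjective ρ hsurj, ← RingHom.ker_eq_comap_bot, (RingHom.injective_iff_ker_eq_bot ρ).1 hinj, sup_bot_eq]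
  rw [hcomap]
  exact Ideal.comap_isPrime ρ _

end Bridge

end Summit.ResolutionOfSingularities.ResolutionOfSingularities.Theorems.FInjectiveMacaulayfication.PencilIntegral

end
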